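import Mathlib
import HarnessLib
import Summits.NavierStokesRegularity.FluidComputer.TriggeredTransferRun
import Summits.NavierStokesRegularity.FluidComputer.TriggeredTransferSums

/-!
# The clock and the geometry of a linked run: magnifications, level durations, start times, the
# blow-up time `T* = Σ_n T_n λ^{-2n} < ∞`, child centres, the blow-up ball, and the summable sizes
# of the zoomed seeds

Cell `ns-blowup`, seat `ns-blowup-fc-prover-1` (D-0074 GROUP C «bridge support», door N1-FC); second
file of the cascade-gluing argument over `TriggeredTransfer.lean` / `TriggeredTransferRun.lean`.
LABEL: E–C bookkeeping (real analysis only). WHAT THIS IS NOT: not Navier–Stokes evidence and not a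
construction — statements about the scalar data of a `TriggerScheme.Run ν`, a type inhabited only
under the OPEN predicate `TriggerScheme.Transfers ν`; no instance is claimed.

Level `n` of a run lives at length scale `λ^{-n}` (`mag n = λⁿ`) and hence, by the parabolic
scaling of the Navier–Stokes system at fixed viscosity, at time scale `λ^{-2n}`:

* `dur n = T_n / mag n ^ 2`, `margin n = δ_n / mag n ^ 2`; start times
  `start n = Σ_{k<n} dur k`; blow-up time `Tstar = Σ' dur`, FINITE because the level clock is
  polynomial in the level (`Run.T_le_geometric`: `T_n ≤ C_τ (1 + n² log λ)^q / (U_0 growthⁿ)`) —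
  `summable_dur`, `start_lt_Tstar`, `tendsto_start`;
* the window on which level `n` is THE solution ends at `stop n = start (n+1) + lap n`,
  `lap n = min (margin n) (margin (n+1))` (the unforced overlap with level `n+1`);
  `start (n+1) < stop n < start (n+2)`, `stop n < stop (n+1)`, `stop n < Tstar`;
* child centres `centre n = Σ_{k<n} (mag k)⁻¹ • x₀_k`, `‖centre n‖ ≤ D λ/(λ-1)`; the ball of radius
  `ballRadius = R + D λ/(λ-1)` contains every zoomed nest ball (`norm_centre_add_le`) — the
  velocity floors live there and the zoomed triggers are supported there (`R_le_norm_mag_smul_sub`);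
* summable sizes (`TriggeredTransferSums.lean`: `Σ_n Mⁿ exp (-κ gⁿ) < ∞`, `Σ_n Mⁿ λ^{-n²} < ∞`),
  whence the level-seed sizes `mag n ^ k · seedAt ν n (U n)` are summable for every `k`
  (`summable_mag_pow_mul_seedAt`) — the `C^m` budget of the summed force, `k = 3 + 2m`.

References: T. Tao, J. Amer. Math. Soc. 29 (2016) §1.3; C. L. Fefferman, Clay problem (C).
0 sorry; axioms ⊆ {propext, Classical.choice, Quot.sound}.
-/

noncomputable section

namespace Summit.NavierStokesRegularity.FluidComputer.TriggeredTransfer.TriggerScheme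

open Set Filter Function Finset
open scoped Topology BigOperators
open Literature.Analysis.FluidPDE
open Literature.Analysis.FluidPDE.FluidComputer (E3 Vel)

variable (𝒮 : TriggerScheme)

/-! ## Magnification factors -/

/-- **The magnification factor of level `n`**: `mag n = λⁿ` (level `n` lives at length scale `λ^{-n}` and
time scale `λ^{-2n}`). [folklore] -/
def mag (n : ℕ) : ℝ := 𝒮.lam ^ n

/-- `mag n > 0`. [folklore] -/
theorem mag_pos (n : ℕ) : 0 < 𝒮.mag n := pow_pos 𝒮.lam_pos n

/-- `mag n ≥ 1`. [folklore] -/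
theorem one_le_mag (n : ℕ) : 1 ≤ 𝒮.mag n := one_le_pow₀ 𝒮.one_lt_lam.le

/-- `mag 0 = 1`. [folklore] -/
@[simp] theorem mag_zero : 𝒮.mag 0 = 1 := pow_zero _

/-- `mag (n+1) = mag n · λ`. [folklore] -/
theorem mag_succ (n : ℕ) : 𝒮.mag (n + 1) = 𝒮.mag n * 𝒮.lam := pow_succ _ _

/-- `(mag n)⁻¹ ≤ 1`. [folklore] -/
theorem mag_inv_le_one (n : ℕ) : (𝒮.mag n)⁻¹ ≤ 1 := inv_le_one_of_one_le₀ (𝒮.one_le_mag n)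

/-- `(mag n)⁻¹ = (λ⁻¹)ⁿ`. [folklore] -/
theorem mag_inv (n : ℕ) : (𝒮.mag n)⁻¹ = 𝒮.lam⁻¹ ^ n := by rw [mag, inv_pow]

/-- **The radius of the blow-up ball**: `R + D λ/(λ - 1)` — every zoomed nest ball
`centre n + (mag n)⁻¹ B̄(0, R)` lies in `B̄(0, ballRadius)`. [folklore] -/
def ballRadius : ℝ := 𝒮.R + 𝒮.D * (𝒮.lam / (𝒮.lam - 1))

/-- The geometric factor `λ/(λ-1)` is at least `1`. [folklore] -/
theorem one_le_lam_div : 1 ≤ 𝒮.lam / (𝒮.lam - 1) := by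
  rw [le_div_iff₀ (by linarith [𝒮.one_lt_lam])]
  linarith [𝒮.one_lt_lam]

/-- Partial geometric sums of `λ^{-k}` are below `λ/(λ-1)`. [folklore] -/
theorem sum_mag_inv_le (n : ℕ) : ∑ k ∈ range n, (𝒮.mag k)⁻¹ ≤ 𝒮.lam / (𝒮.lam - 1) := by
  have h0 : 0 ≤ 𝒮.lam⁻¹ := inv_nonneg.2 𝒮.lam_pos.le
  have h1 : 𝒮.lam⁻¹ < 1 := inv_lt_one_of_one_lt₀ 𝒮.one_lt_lam
  simp_rw [mag_inv]
  calc ∑ k ∈ range n, 𝒮.lam⁻¹ ^ k = ∑ k ∈ Ico 0 n, 𝒮.lam⁻¹ ^ k := by rw [range_eq_Ico]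
    _ ≤ 𝒮.lam⁻¹ ^ 0 / (1 - 𝒮.lam⁻¹) := geom_sum_Ico_le_of_lt_one h0 h1
    _ = 𝒮.lam / (𝒮.lam - 1) := by
        have hl : 𝒮.lam ≠ 0 := 𝒮.lam_pos.ne'
        have hl1 : 𝒮.lam - 1 ≠ 0 := by linarith [𝒮.one_lt_lam]
        rw [pow_zero]
        field_simp

/-- `R ≤ ballRadius`. [folklore] -/
theorem R_le_ballRadius : 𝒮.R ≤ 𝒮.ballRadius :=
  le_add_of_nonneg_right (mul_nonneg 𝒮.D_nonneg (zero_le_one.trans 𝒮.one_le_lam_div))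

/-- `0 < ballRadius`. [folklore] -/
theorem ballRadius_pos : 0 < 𝒮.ballRadius := 𝒮.R_pos.trans_le 𝒮.R_le_ballRadius

namespace Run

variable {𝒮} {ν : ℝ} (ρ : 𝒮.Run ν)

/-! ## Durations, margins, start times, the blow-up time -/

/-- **Physical duration of level `n`**: `T_n / λ^{2n}` (hand-over time in the level's own clock,
zoomed). [folklore] -/
def dur (n : ℕ) : ℝ := (ρ.link n).T / 𝒮.mag n ^ 2

/-- **Physical margin of level `n`**: `δ_n / λ^{2n}`. [folklore] -/
def margin (n : ℕ) : ℝ := (ρ.link n).δ / 𝒮.mag n ^ 2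

/-- Durations are positive. [folklore] -/
theorem dur_pos (n : ℕ) : 0 < ρ.dur n := div_pos (ρ.link n).T_pos (pow_pos (𝒮.mag_pos n) 2)

/-- Margins are positive. [folklore] -/
theorem margin_pos (n : ℕ) : 0 < ρ.margin n := div_pos (ρ.link n).δ_pos (pow_pos (𝒮.mag_pos n) 2)

/-- `margin n < dur n` (`δ < T`). [folklore] -/
theorem margin_lt_dur (n : ℕ) : ρ.margin n < ρ.dur n :=
  div_lt_div_of_pos_right (ρ.link n).δ_lt_T (pow_pos (𝒮.mag_pos n) 2)

/-- `2 · margin n < dur n` (`2δ < T`). [folklore] -/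
theorem two_mul_margin_lt_dur (n : ℕ) : 2 * ρ.margin n < ρ.dur n := by
  rw [margin, dur, mul_div_assoc']
  exact div_lt_div_of_pos_right (ρ.link n).two_δ_lt (pow_pos (𝒮.mag_pos n) 2)

/-- `dur n ≤ T_n` (the zoom only shortens). [folklore] -/
theorem dur_le_T (n : ℕ) : ρ.dur n ≤ (ρ.link n).T :=
  div_le_self (ρ.link n).T_pos.le (one_le_pow₀ (𝒮.one_le_mag n))

/-- Unzooming a physical time offset: `mag n ^ 2 · dur n = T_n`. [folklore] -/
theorem mag_sq_mul_dur (n : ℕ) : 𝒮.mag n ^ 2 * ρ.dur n = (ρ.link n).T :=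
  mul_div_cancel₀ _ (pow_pos (𝒮.mag_pos n) 2).ne'

/-- Unzooming a physical time offset: `mag n ^ 2 · margin n = δ_n`. [folklore] -/
theorem mag_sq_mul_margin (n : ℕ) : 𝒮.mag n ^ 2 * ρ.margin n = (ρ.link n).δ :=
  mul_div_cancel₀ _ (pow_pos (𝒮.mag_pos n) 2).ne'

/-- **Start time of level `n`**: `Σ_{k<n} dur k`. [folklore] -/
def start (n : ℕ) : ℝ := ∑ k ∈ range n, ρ.dur k

/-- `start 0 = 0`. [folklore] -/
@[simp] theorem start_zero : ρ.start 0 = 0 := sum_range_zero _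

/-- `start (n+1) = start n + dur n`. [folklore] -/
theorem start_succ (n : ℕ) : ρ.start (n + 1) = ρ.start n + ρ.dur n := sum_range_succ _ _

/-- Start times are non-negative. [folklore] -/
theorem start_nonneg (n : ℕ) : 0 ≤ ρ.start n := sum_nonneg fun k _ => (ρ.dur_pos k).le

/-- Start times increase strictly. [folklore] -/
theorem start_lt_start_succ (n : ℕ) : ρ.start n < ρ.start (n + 1) := by
  rw [ρ.start_succ]; exact lt_add_of_pos_right _ (ρ.dur_pos n)

/-- Start times increase strictly. [folklore] -/
theorem strictMono_start : StrictMono ρ.start := strictMono_nat_of_lt_succ ρ.start_lt_start_succ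

/-- Start times are monotone. [folklore] -/
theorem monotone_start : Monotone ρ.start := ρ.strictMono_start.monotone

/-- **The level durations are summable** (`ν > 0`): `dur n ≤ T_n ≤ C_τ (1 + n² log λ)^q/(U_0 growthⁿ)`,
a polynomial over an exponential. [folklore] -/
theorem summable_dur (hν : 0 < ν) : Summable ρ.dur := by
  have hmaj : Summable (fun n : ℕ => 𝒮.Cτ / ρ.U 0 *
      ((1 + (n : ℝ) ^ 2 * Real.log 𝒮.lam) ^ 𝒮.q / 𝒮.growth ^ n)) :=
    (summable_poly_div_pow (Real.log_nonneg 𝒮.one_lt_lam.le) 𝒮.one_lt_growth 𝒮.q).mul_left _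
  refine hmaj.of_nonneg_of_le (fun n => (ρ.dur_pos n).le) (fun n => ?_)
  calc ρ.dur n ≤ (ρ.link n).T := ρ.dur_le_T n
    _ ≤ 𝒮.Cτ * (1 + (n : ℝ) ^ 2 * Real.log 𝒮.lam) ^ 𝒮.q / (ρ.U 0 * 𝒮.growth ^ n) :=
        ρ.T_le_geometric hν n
    _ = 𝒮.Cτ / ρ.U 0 * ((1 + (n : ℝ) ^ 2 * Real.log 𝒮.lam) ^ 𝒮.q / 𝒮.growth ^ n) := by
        have h1 : ρ.U 0 ≠ 0 := (ρ.U_pos 0).ne'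
        have h2 : 𝒮.growth ^ n ≠ 0 := (pow_pos 𝒮.growth_pos n).ne'
        field_simp

/-- **The blow-up time** `T* = Σ_n dur n`. [folklore] -/
def Tstar : ℝ := ∑' n, ρ.dur n

/-- `T* = start n + Σ_{i} dur (i + n)` (splitting off the first `n` levels). [folklore] -/
theorem Tstar_eq_start_add (hν : 0 < ν) (n : ℕ) :
    ρ.Tstar = ρ.start n + ∑' i, ρ.dur (i + n) :=
  ((ρ.summable_dur hν).sum_add_tsum_nat_add n).symm

/-- Every start time is strictly before the blow-up time. [folklore] -/
theorem start_lt_Tstar (hν : 0 < ν) (n : ℕ) : ρ.start n < ρ.Tstar := by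
  rw [ρ.Tstar_eq_start_add hν n]
  have htail : 0 < ∑' i, ρ.dur (i + n) :=
    ((summable_nat_add_iff n).2 (ρ.summable_dur hν)).tsum_pos (fun i => (ρ.dur_pos _).le) 0
      (ρ.dur_pos _)
  linarith

/-- The blow-up time is positive. [folklore] -/
theorem Tstar_pos (hν : 0 < ν) : 0 < ρ.Tstar := by
  simpa using ρ.start_lt_Tstar hν 0

/-- The start times converge to the blow-up time. [folklore] -/
theorem tendsto_start (hν : 0 < ν) : Tendsto ρ.start atTop (𝓝 ρ.Tstar) :=
  (ρ.summable_dur hν).tendsto_sum_tsum_nat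

/-- Every time before `T*` is passed by the start times. [folklore] -/
theorem exists_lt_start (hν : 0 < ν) {t : ℝ} (ht : t < ρ.Tstar) : ∃ n, t < ρ.start n :=
  ((ρ.tendsto_start hν).eventually (eventually_gt_nhds ht)).exists

/-! ## The windows: overlaps and stops -/

/-- **Length of the unforced overlap** after the hand-over of level `n`:
`min (margin n) (margin (n+1))` — both pieces are unforced there. [folklore] -/
def lap (n : ℕ) : ℝ := min (ρ.margin n) (ρ.margin (n + 1))

/-- Overlaps are positive. [folklore] -/
theorem lap_pos (n : ℕ) : 0 < ρ.lap n := lt_min (ρ.margin_pos n) (ρ.margin_pos (n + 1))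

/-- `lap n ≤ margin n`. [folklore] -/
theorem lap_le_margin (n : ℕ) : ρ.lap n ≤ ρ.margin n := min_le_left _ _

/-- `lap n ≤ margin (n+1)`. [folklore] -/
theorem lap_le_margin_succ (n : ℕ) : ρ.lap n ≤ ρ.margin (n + 1) := min_le_right _ _

/-- **The stop of level `n`**: `start (n+1) + lap n`, the right end of the window `[start n, stop n)`
on which the glued solution is (taken to be) the piece of level `n`. [folklore] -/
def stop (n : ℕ) : ℝ := ρ.start (n + 1) + ρ.lap n

/-- `start (n+1) < stop n`. [folklore] -/
theorem start_succ_lt_stop (n : ℕ) : ρ.start (n + 1) < ρ.stop n :=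
  lt_add_of_pos_right _ (ρ.lap_pos n)

/-- `start n < stop n`. [folklore] -/
theorem start_lt_stop (n : ℕ) : ρ.start n < ρ.stop n :=
  (ρ.start_lt_start_succ n).trans (ρ.start_succ_lt_stop n)

/-- `0 < stop n`. [folklore] -/
theorem stop_pos (n : ℕ) : 0 < ρ.stop n := (ρ.start_nonneg n).trans_lt (ρ.start_lt_stop n)

/-- The window of level `n` ends inside the life span of its piece:
`stop n ≤ start n + dur n + margin n`. [folklore] -/
theorem stop_le_life (n : ℕ) : ρ.stop n ≤ ρ.start n + ρ.dur n + ρ.margin n := by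
  rw [stop, start_succ]
  linarith [ρ.lap_le_margin n]

/-- The window of level `n` ends inside the initial unforced layer of the next piece:
`stop n ≤ start (n+1) + margin (n+1)`. [folklore] -/
theorem stop_le_start_succ_add_margin (n : ℕ) : ρ.stop n ≤ ρ.start (n + 1) + ρ.margin (n + 1) :=
  add_le_add le_rfl (ρ.lap_le_margin_succ n)

/-- `stop n < start (n+2)` (the overlap is shorter than the next duration: `δ < T`). [folklore] -/
theorem stop_lt_start_add_two (n : ℕ) : ρ.stop n < ρ.start (n + 2) := by
  rw [show n + 2 = (n + 1) + 1 by ring, ρ.start_succ (n + 1)]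
  exact add_lt_add_of_le_of_lt le_rfl ((ρ.lap_le_margin_succ n).trans_lt (ρ.margin_lt_dur (n + 1)))

/-- The stops increase strictly. [folklore] -/
theorem stop_lt_stop_succ (n : ℕ) : ρ.stop n < ρ.stop (n + 1) :=
  (ρ.stop_lt_start_add_two n).trans (ρ.start_succ_lt_stop (n + 1))

/-- The stops increase strictly. [folklore] -/
theorem strictMono_stop : StrictMono ρ.stop := strictMono_nat_of_lt_succ ρ.stop_lt_stop_succ

/-- The stops are monotone. [folklore] -/
theorem monotone_stop : Monotone ρ.stop := ρ.strictMono_stop.monotone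

/-- Every stop is strictly before the blow-up time. [folklore] -/
theorem stop_lt_Tstar (hν : 0 < ν) (n : ℕ) : ρ.stop n < ρ.Tstar :=
  (ρ.stop_lt_start_add_two n).trans (ρ.start_lt_Tstar hν (n + 2))

/-- Every time before `T*` is passed by the stops. [folklore] -/
theorem exists_lt_stop (hν : 0 < ν) {t : ℝ} (ht : t < ρ.Tstar) : ∃ n, t < ρ.stop n := by
  obtain ⟨n, hn⟩ := ρ.exists_lt_start hν ht
  exact ⟨n, hn.trans (ρ.start_lt_stop n)⟩

/-- The first level whose stop passes a given time `t < T*` (well defined by `exists_lt_stop`). [folklore] -/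
def level (hν : 0 < ν) {t : ℝ} (ht : t < ρ.Tstar) : ℕ := Nat.find (ρ.exists_lt_stop hν ht)

/-- The defining property of `level`: `t < stop (level t)`. [folklore] -/
theorem lt_stop_level (hν : 0 < ν) {t : ℝ} (ht : t < ρ.Tstar) : t < ρ.stop (ρ.level hν ht) :=
  Nat.find_spec (ρ.exists_lt_stop hν ht)

/-- Minimality of `level`: earlier stops do not pass `t`. [folklore] -/
theorem stop_le_of_lt_level (hν : 0 < ν) {t : ℝ} (ht : t < ρ.Tstar) {m : ℕ}
    (hm : m < ρ.level hν ht) : ρ.stop m ≤ t :=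
  not_lt.1 (Nat.find_min (ρ.exists_lt_stop hν ht) hm)

/-! ## Child centres and the blow-up ball -/

/-- **The centre of level `n`** (physical space): `Σ_{k<n} (mag k)⁻¹ • x₀_k` — each hand-over
displaces the child's centre by `x₀_k` at the parent's scale `λ^{-k}`. [folklore] -/
def centre (n : ℕ) : E3 := ∑ k ∈ range n, (𝒮.mag k)⁻¹ • (ρ.link k).x₀

/-- `centre 0 = 0`. [folklore] -/
@[simp] theorem centre_zero : ρ.centre 0 = 0 := sum_range_zero _

/-- `centre (n+1) = centre n + (mag n)⁻¹ • x₀_n`. [folklore] -/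
theorem centre_succ (n : ℕ) : ρ.centre (n + 1) = ρ.centre n + (𝒮.mag n)⁻¹ • (ρ.link n).x₀ :=
  sum_range_succ _ _

/-- **The centres stay in a fixed ball**: `‖centre n‖ ≤ D λ/(λ-1)`. [folklore] -/
theorem norm_centre_le (n : ℕ) : ‖ρ.centre n‖ ≤ 𝒮.D * (𝒮.lam / (𝒮.lam - 1)) := by
  calc ‖ρ.centre n‖ ≤ ∑ k ∈ range n, ‖(𝒮.mag k)⁻¹ • (ρ.link k).x₀‖ := norm_sum_le _ _
    _ ≤ ∑ k ∈ range n, 𝒮.D * (𝒮.mag k)⁻¹ := by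
        refine sum_le_sum fun k _ => ?_
        rw [norm_smul, Real.norm_of_nonneg (inv_nonneg.2 (𝒮.mag_pos k).le), mul_comm]
        exact mul_le_mul_of_nonneg_right (ρ.link k).norm_x₀_le (inv_nonneg.2 (𝒮.mag_pos k).le)
    _ = 𝒮.D * ∑ k ∈ range n, (𝒮.mag k)⁻¹ := by rw [mul_sum]
    _ ≤ 𝒮.D * (𝒮.lam / (𝒮.lam - 1)) := mul_le_mul_of_nonneg_left (𝒮.sum_mag_inv_le n) 𝒮.D_nonneg

/-- **Zoomed nest balls lie in the blow-up ball**: `‖y‖ ≤ R ⇒ ‖centre n + (mag n)⁻¹ • y‖ ≤ ballRadius`. [folklore] -/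
theorem norm_centre_add_le (n : ℕ) {y : E3} (hy : ‖y‖ ≤ 𝒮.R) :
    ‖ρ.centre n + (𝒮.mag n)⁻¹ • y‖ ≤ 𝒮.ballRadius := by
  calc ‖ρ.centre n + (𝒮.mag n)⁻¹ • y‖ ≤ ‖ρ.centre n‖ + ‖(𝒮.mag n)⁻¹ • y‖ := norm_add_le _ _
    _ ≤ 𝒮.D * (𝒮.lam / (𝒮.lam - 1)) + 𝒮.R := by
        refine add_le_add (ρ.norm_centre_le n) ?_
        rw [norm_smul, Real.norm_of_nonneg (inv_nonneg.2 (𝒮.mag_pos n).le)]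
        exact (mul_le_of_le_one_left (norm_nonneg y) (𝒮.mag_inv_le_one n)).trans hy
    _ = 𝒮.ballRadius := by rw [ballRadius, add_comm]

/-- **Outside the blow-up ball every zoomed trigger is off**: if `ballRadius ≤ ‖x‖` then the
level-`n` coordinate `mag n • (x - centre n)` of `x` lies outside the nest ball, `R ≤ ‖·‖`. [folklore] -/
theorem R_le_norm_mag_smul_sub (n : ℕ) {x : E3} (hx : 𝒮.ballRadius ≤ ‖x‖) :
    𝒮.R ≤ ‖𝒮.mag n • (x - ρ.centre n)‖ := by
  have h1 : 𝒮.R ≤ ‖x - ρ.centre n‖ := by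
    have h2 : ‖x‖ - ‖ρ.centre n‖ ≤ ‖x - ρ.centre n‖ := norm_sub_norm_le x (ρ.centre n)
    have h3 : 𝒮.ballRadius = 𝒮.R + 𝒮.D * (𝒮.lam / (𝒮.lam - 1)) := rfl
    linarith [ρ.norm_centre_le n]
  rw [norm_smul, Real.norm_of_nonneg (𝒮.mag_pos n).le]
  exact h1.trans (le_mul_of_one_le_left (norm_nonneg _) (𝒮.one_le_mag n))

/-! ## Summable sizes of the zoomed seeds -/

/-- **The `C^m` budget of the summed force is finite**: for every exponent `k`,
`Σ_n (mag n)^k · ε_n < ∞` along a run (`ν > 0`), because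
`ε_n ≤ exp (-(a U_0/ν) growthⁿ) + λ^{-n²}` (`Run.exp_seed_le_geometric`, `seedAt_le_add`) and both
majorants are summable against `λ^{kn}`. Used with `k = 3 + 2m` for the `m`-th derivative of the
level-`n` zoomed trigger. [folklore] -/
theorem summable_mag_pow_mul_seedAt (hν : 0 < ν) (k : ℕ) :
    Summable (fun n : ℕ => 𝒮.mag n ^ k * 𝒮.seedAt ν n (ρ.U n)) := by
  have hM : 0 < 𝒮.lam ^ k := pow_pos 𝒮.lam_pos k
  have hκ : 0 < 𝒮.a * ρ.U 0 / ν := div_pos (mul_pos 𝒮.a_pos (ρ.U_pos 0)) hν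
  have hmaj : Summable (fun n : ℕ => (𝒮.lam ^ k) ^ n * Real.exp (-(𝒮.a * ρ.U 0 / ν * 𝒮.growth ^ n))
      + (𝒮.lam ^ k) ^ n * (𝒮.lam ^ (n ^ 2))⁻¹) :=
    (summable_pow_mul_exp_neg_mul_pow hM hκ 𝒮.one_lt_growth).add
      (summable_pow_mul_pow_sq_inv hM 𝒮.one_lt_lam)
  refine hmaj.of_nonneg_of_le
    (fun n => mul_nonneg (pow_nonneg (𝒮.mag_pos n).le k) (𝒮.seedAt_pos ν n _).le) (fun n => ?_)
  have hz : 𝒮.mag n ^ k = (𝒮.lam ^ k) ^ n := by rw [mag, ← pow_mul, ← pow_mul, mul_comm]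
  rw [hz, ← mul_add]
  refine mul_le_mul_of_nonneg_left ?_ (pow_nonneg hM.le n)
  refine (𝒮.seedAt_le_add ν n (ρ.U n)).trans (add_le_add ?_ le_rfl)
  refine (ρ.exp_seed_le_geometric hν n).trans (le_of_eq ?_)
  congr 1
  ring

end Run

end Summit.NavierStokesRegularity.FluidComputer.TriggeredTransfer.TriggerScheme

end
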